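import Literature.Computability.QuantumComplexity.UncomputeBranches
import Literature.Computability.QuantumComplexity.CircuitEmbedding
import Literature.Computability.QuantumComplexity.LightCone
import HarnessLib

/-!
# Classical stages local on the reachable labels let the idle gates pass

Topic `Literature/Computability/QuantumComplexity`; sequel of `UncomputeBranches.lean` (`IsBasisMap M κ`),
`RestBlockStates.lean` (`restBlockState`, `Function.extend` bookkeeping), `CircuitEmbedding.lean`
(`placeGate_mulVec_apply`) and `BasisMapLocality.lean` (the operator-level version). A compiled classical stage
of a quantum machine is typically local to a wire set only ON THE REACHABLE LABELS: a Toffoli network whose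
controls include "slot flags" targets the wires `T` of an inactive slot only when a flag is set, and reads them
only under a flag — so as an OPERATOR it is not supported off `T`, but on every label of an invariant set `G`
(flags consistent with the input) it neither changes the wires of `T` nor lets its action depend on them.
This file proves that this weaker, label-set-relative locality suffices:

* `extend_mem_of_offDetermined` — a label set determined off `T` is stable under writing a block inside `T`;
* `LocalOn.apply_extend` — for `c ∈ G`, `κ (c with block f) = (κ c) with block f`;
* `IsBasisMap.mulVec_restBlockState_of_localOn` — `M (|c⟩ ⊗ |φ⟩) = |κ c⟩ ⊗ |φ⟩` for `c ∈ G`;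
* **`IsBasisMap.mulVec_placeGate_comm_of_localOn`** — for a state supported on `G` and a gate placed inside `T`,
  `M (U ψ) = U (M ψ)`;
* `placeGate_mulVec_supportedIn`, `IsBasisMap.mulVec_supportedIn` — support on `G` is preserved;
* **`IsBasisMap.mulVec_toMatrix_comm_of_localOn`** — the same for a whole gate list inside `T`.

In Regev's one-copy sampler (J. ACM 56 (2009), art. 34, Lemma 3.14) this lets the gates of the inactive
subroutine slots and unused coordinate slots commute past the flag-controlled classical stages, after which
`IdleGatesInvariance.lean` deletes them.

Everything is proved; no named fact is introduced.

## References

* M. A. Nielsen, I. L. Chuang, *Quantum Computation and Quantum Information*, CUP 2010, §2.1.7 eq. (2.45),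
  §3.2.5, §4.2, §4.3 (controlled operations) [NielsenChuang2010].
* E. Bernstein, U. Vazirani, *Quantum complexity theory*, SIAM J. Comput. 26 (1997) 1411–1473, §8.2
  [BernsteinVazirani1997].
* O. Regev, *On lattices, learning with errors, random linear codes, and cryptography*, J. ACM 56 (2009),
  art. 34, Lemma 3.14 (proof) [Regev2009].
-/

noncomputable section

open Matrix Finset

namespace Literature.Computability.QuantumComplexity

open Cryptography LightCone

variable {W b : ℕ} {M : Matrix (QReg W) (QReg W) ℂ} {κ : QReg W → QReg W} {T : Finset (Fin W)} {G : Set (QReg W)}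

/-- **Label-set-relative locality** of a relabelling `κ` to the wire set `T` on the label set `G`: `G` is
determined by the wires off `T`, and on `G` the map `κ` fixes the wires of `T` and its values off `T` do not
depend on the content of `T`. [cite: NielsenChuang2010, §4.3 (controlled operations), §3.2.5] -/
structure LocalOn (κ : QReg W → QReg W) (T : Finset (Fin W)) (G : Set (QReg W)) : Prop where
  offDetermined : ∀ z z' : QReg W, (∀ w, w ∉ T → z w = z' w) → z ∈ G → z' ∈ G
  fix : ∀ z ∈ G, ∀ w ∈ T, κ z w = z w
  indep : ∀ z ∈ G, ∀ z' ∈ G, (∀ w, w ∉ T → z w = z' w) → ∀ w, w ∉ T → κ z w = κ z' w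

/-- Writing a block inside `T` does not change the wires off `T`. [folklore] -/
theorem extend_eq_off (E : Fin b ↪ Fin W) (hE : ∀ i, E i ∈ T) (f : QReg b) (c : QReg W) :
    ∀ w, w ∉ T → Function.extend E f c w = c w :=
  fun _ hw => extend_apply_of_not_mem E f c fun ⟨i, hi⟩ => hw (hi ▸ hE i)

/-- A label set determined off `T` is stable under writing a block inside `T`. [folklore] -/
theorem extend_mem_of_offDetermined (hκ : LocalOn κ T G) (E : Fin b ↪ Fin W) (hE : ∀ i, E i ∈ T) (f : QReg b)
    {c : QReg W} (hc : c ∈ G) : Function.extend E f c ∈ G :=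
  hκ.offDetermined c _ (fun w hw => (extend_eq_off E hE f c w hw).symm) hc

/-- **On `G`, the relabelling commutes with writing a block inside `T`.** [cite: NielsenChuang2010, §4.3] -/
theorem LocalOn.apply_extend (hκ : LocalOn κ T G) (E : Fin b ↪ Fin W) (hE : ∀ i, E i ∈ T) (f : QReg b)
    {c : QReg W} (hc : c ∈ G) : κ (Function.extend E f c) = Function.extend E f (κ c) := by
  have hc' : Function.extend E f c ∈ G := extend_mem_of_offDetermined hκ E hE f hc
  funext w
  by_cases hw : w ∈ Set.range E
  · obtain ⟨i, rfl⟩ := hw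
    rw [hκ.fix _ hc' _ (hE i), E.injective.extend_apply, E.injective.extend_apply]
  · rw [extend_apply_of_not_mem E f (κ c) hw]
    by_cases hT : w ∈ T
    · rw [hκ.fix _ hc' _ hT, extend_apply_of_not_mem E f c hw, hκ.fix _ hc _ hT]
    · exact hκ.indep _ hc' _ hc (extend_eq_off E hE f c) w hT

/-- **A basis map local on `G` acts on the classical rest of a block state with rest label in `G`.**
[cite: NielsenChuang2010, §2.1.7 eq. (2.45), §3.2.5] -/
theorem IsBasisMap.mulVec_restBlockState_of_localOn (h : IsBasisMap M κ) (hκ : LocalOn κ T G)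
    (E : Fin b ↪ Fin W) (hE : ∀ i, E i ∈ T) (φ : QReg b → ℂ) {c : QReg W} (hc : c ∈ G) :
    M *ᵥ restBlockState E φ c = restBlockState E φ (κ c) := by
  rw [restBlockState_eq_sum, Matrix.mulVec_sum]
  simp_rw [Matrix.mulVec_smul, show ∀ z, M *ᵥ basisState z = basisState (κ z) from h, hκ.apply_extend E hE _ hc]
  rw [← restBlockState_eq_sum]

/-- **A classical stage local on the reachable labels commutes with a gate inside `T`** on every state
supported on `G`. [cite: NielsenChuang2010, §2.1.7 eq. (2.45), §4.3] [cite: Regev2009, Lemma 3.14 (proof)] -/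
theorem IsBasisMap.mulVec_placeGate_comm_of_localOn (h : IsBasisMap M κ) (hκ : LocalOn κ T G)
    (E : Fin b ↪ Fin W) (hE : ∀ i, E i ∈ T) (U : Matrix (QReg b) (QReg b) ℂ) {ψ : QReg W → ℂ}
    (hψ : ∀ z, z ∉ G → ψ z = 0) : M *ᵥ (placeGate E U *ᵥ ψ) = placeGate E U *ᵥ (M *ᵥ ψ) := by
  have hfixE : ∀ z ∈ G, κ z ∘ E = z ∘ E := fun z hz => funext fun i => hκ.fix z hz _ (hE i)
  conv_lhs => rw [state_eq_sum_smul_basisState ψ]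
  rw [h.mulVec_eq_sum ψ, Matrix.mulVec_sum, Matrix.mulVec_sum, Matrix.mulVec_sum]
  refine Finset.sum_congr rfl fun z _ => ?_
  by_cases hz : z ∈ G
  · rw [Matrix.mulVec_smul, Matrix.mulVec_smul, Matrix.mulVec_smul, basisState_eq_restBlockState E z,
      placeGate_mulVec_restBlockState, h.mulVec_restBlockState_of_localOn hκ E hE _ hz,
      basisState_eq_restBlockState E (κ z), placeGate_mulVec_restBlockState, hfixE z hz]
  · rw [hψ z hz, zero_smul, zero_smul, Matrix.mulVec_zero, Matrix.mulVec_zero]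

/-- A gate inside `T` preserves support on a label set determined off `T`. [folklore] -/
theorem placeGate_mulVec_supportedIn (hκ : LocalOn κ T G) (E : Fin b ↪ Fin W) (hE : ∀ i, E i ∈ T)
    (U : Matrix (QReg b) (QReg b) ℂ) {ψ : QReg W → ℂ} (hψ : ∀ z, z ∉ G → ψ z = 0) :
    ∀ z, z ∉ G → (placeGate E U *ᵥ ψ) z = 0 := by
  intro x hx
  rw [placeGate_mulVec_apply]
  refine Finset.sum_eq_zero fun g _ => ?_
  rw [hψ _ fun hg => hx ?_, mul_zero]
  exact hκ.offDetermined _ _ (extend_eq_off E hE g x) hg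

/-- A basis map mapping `G` into `G` preserves support on `G`. [folklore] -/
theorem IsBasisMap.mulVec_supportedIn (h : IsBasisMap M κ) (hG : ∀ z ∈ G, κ z ∈ G) {ψ : QReg W → ℂ}
    (hψ : ∀ z, z ∉ G → ψ z = 0) : ∀ z, z ∉ G → (M *ᵥ ψ) z = 0 := by
  intro x hx
  rw [h.mulVec_eq_sum ψ, Finset.sum_apply]
  refine Finset.sum_eq_zero fun z _ => ?_
  rw [Pi.smul_apply, basisState_apply, smul_eq_mul]
  by_cases hz : z ∈ G
  · rw [if_neg (show ¬x = κ z from fun hxz => hx (by rw [hxz]; exact hG z hz)), mul_zero]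
  · rw [hψ z hz, zero_mul]

/-- One gate of the gate set inside `T`: commutation on states supported on `G`. [cite: NielsenChuang2010, §4.2, §4.3] -/
theorem IsBasisMap.mulVec_gate_comm_of_localOn {GS : QGateSet} (A : Language Bool) (h : IsBasisMap M κ)
    (hκ : LocalOn κ T G) (g : QGate GS W) (hg : g.wires ⊆ T) {ψ : QReg W → ℂ} (hψ : ∀ z, z ∉ G → ψ z = 0) :
    M *ᵥ (g.toMatrix A *ᵥ ψ) = g.toMatrix A *ᵥ (M *ᵥ ψ) ∧ ∀ z, z ∉ G → (g.toMatrix A *ᵥ ψ) z = 0 := by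
  cases g with
  | gate g e =>
    have hE : ∀ i, e i ∈ T := fun i => hg ((mem_wires_gate_iff g e (e i)).2 ⟨i, rfl⟩)
    rw [QGate.toMatrix_gate]
    exact ⟨h.mulVec_placeGate_comm_of_localOn hκ e hE _ hψ, placeGate_mulVec_supportedIn hκ e hE _ hψ⟩
  | oracle k e =>
    have hE : ∀ i, e i ∈ T := fun i => hg ((mem_wires_oracle_iff k e (e i)).2 ⟨i, rfl⟩)
    rw [QGate.toMatrix_oracle]
    exact ⟨h.mulVec_placeGate_comm_of_localOn hκ e hE _ hψ, placeGate_mulVec_supportedIn hκ e hE _ hψ⟩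

/-- **A classical stage local on the reachable labels lets a whole gate list inside `T` pass**, and the
gate list preserves support on `G`. [cite: NielsenChuang2010, §2.1.7 eq. (2.45), §4.3] [cite: Regev2009, Lemma 3.14 (proof)] -/
theorem IsBasisMap.mulVec_toMatrix_comm_of_localOn {GS : QGateSet} (A : Language Bool) (h : IsBasisMap M κ)
    (hκ : LocalOn κ T G) :
    ∀ {gs : List (QGate GS W)}, (∀ g ∈ gs, g.wires ⊆ T) → ∀ {ψ : QReg W → ℂ}, (∀ z, z ∉ G → ψ z = 0) →
      M *ᵥ ((⟨gs⟩ : QCircuit GS W).toMatrix A *ᵥ ψ) = (⟨gs⟩ : QCircuit GS W).toMatrix A *ᵥ (M *ᵥ ψ) ∧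
        ∀ z, z ∉ G → ((⟨gs⟩ : QCircuit GS W).toMatrix A *ᵥ ψ) z = 0
  | [], _, ψ, hψ => by
    rw [QCircuit.toMatrix_nil, Matrix.one_mulVec, Matrix.one_mulVec]
    exact ⟨rfl, hψ⟩
  | g :: gs, hgs, ψ, hψ => by
    have h1 := h.mulVec_gate_comm_of_localOn A hκ g (hgs g List.mem_cons_self) hψ
    have h2 := h.mulVec_toMatrix_comm_of_localOn A hκ (gs := gs) (fun g' hg' => hgs g' (List.mem_cons_of_mem g hg')) h1.2
    rw [QCircuit.toMatrix_cons, ← Matrix.mulVec_mulVec, ← Matrix.mulVec_mulVec]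
    exact ⟨by rw [h2.1, h1.1], h2.2⟩

end Literature.Computability.QuantumComplexity

end
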